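import Summits.QuantumFields.YangMills.Theorems.PencilRigidityHypercubicLimitScaledShiftedBoundZones
import HarnessLib

/-!
# Crux `HypercubicLimit` (stmt-QuantumFields-8646), line `conditional-mean-telescoping`: sub-goal `stub_scaledShiftedBound`

Support file (`--supports stmt-QuantumFields-8646`, c2 seat): the abstract SCALED a-uniform bound at shifted evaluation
points (= `ScaledShiftedBound` of `PencilRigidityHypercubicLimitDefsB.lean`, unfolded; analytic core of the closure's leg
(U) `stub_uniformBound`): `a⁴ⁿ ‖Σₓ W(x) F(y(x))‖ ≤ Kⁿ (Bⁿ + Mⁿ a^{En}) ‖F‖_{(6+E+P) n}` with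
`K = 2¹² · 7 · (81 Σ (m+1)⁻²) · ((24δ)^P + 1 + (3/2)⁶ 12^E + 22^E)`.  The per-point three-zone bound is `ssb_pointwise`
(`…ScaledShiftedBoundZones.lean`); here the weights `∏ₗ 2⁶ (1 + a‖xₗ‖)⁻⁶` extracted from `(1 + ‖y‖)^{6n}` are summed by the
sibling toolkit's `Σₓ ∏ₗ a⁴ (1 + a‖xₗ‖)⁻⁶ ≤ Zⁿ` and the seminorm budget is put against `schwartzNorm ((6+E+P) n)`.
Refs: OsterwalderSchrader1975 §2; GlimmJaffe1987 §6.1.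
-/

set_option autoImplicit false

noncomputable section

open scoped SchwartzMap BigOperators
open MeasureTheory Filter Topology
open Literature.MathematicalPhysics.QuantumFieldTheory Literature.MathematicalPhysics.QuantumLattice
open Literature.MathematicalPhysics.AQFT
open Literature.Probability.LatticeModels (box Site)
open Summit.QuantumFields.YangMills.Theorems.OSLegsFromFemtoAndGap

namespace Summit.QuantumFields.YangMills.Cruxes.HypercubicLimit.ConditionalMeanTelescoping

/-! ### The registered sub-goal -/

/-- **`stub_scaledShiftedBound`** (registered sub-goal of crux stmt-QuantumFields-8646, = `ScaledShiftedBound` of the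
line's vocabulary file B, unfolded): the abstract scaled a-uniform bound at shifted evaluation points, with
`K = 2¹² · 7 · (81 Σ (m+1)⁻²) · ((24δ)^P + 1 + (3/2)⁶ 12^E + 22^E)` and `s = 6 + E + P`. -/
theorem stub_scaledShiftedBound :
    ∀ δ : ℝ, 0 < δ → ∀ P E : ℕ, ∃ (K : ℝ) (s : ℕ), 0 ≤ K ∧
    ∀ n : ℕ, 2 ≤ n → ∀ (L R₀ : ℕ) (a M B : ℝ) (W : (Fin n → Site 4) → ℝ)
      (y : (Fin n → Site 4) → (Fin n → EuclideanSpace ℝ (Fin 4))) (F : 𝓢((Fin n → EuclideanSpace ℝ (Fin 4)), ℂ)),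
      0 < a → a ≤ 1 / 24 → a⁻¹ * a⁻¹ ≤ (L : ℝ) → 1 ≤ R₀ → (R₀ : ℝ) * a ≤ δ → 4 * R₀ + 4 < 2 * L + 1 →
      0 ≤ M → 0 ≤ B → (∀ x, |W x| ≤ M ^ n) →
      (∀ x ∈ Fintype.piFinset (fun _ : Fin n => box 4 L), ∀ R : ℕ, 1 ≤ R → R ≤ R₀ →
        (∀ k l : Fin n, k ≠ l → ∃ μ : Fin 4, (2 * R + 1 : ℤ) < |x k μ - x l μ| ∧ |x k μ - x l μ| ≤ L) →
          |W x| ≤ (B * ((R₀ : ℝ) / R) ^ P) ^ n) →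
      (∀ x l, ‖y x l - a • siteToE (x l)‖ ≤ 6 * a) → IsOffDiagonal F →
        a ^ (4 * n) * ‖∑ x ∈ Fintype.piFinset (fun _ : Fin n => box 4 L), ((W x : ℝ) : ℂ) * F (y x)‖ ≤
          K ^ n * (B ^ n + M ^ n * a ^ (E * n)) * schwartzNorm (s * n) F := by
  classical
  intro δ hδ P E
  obtain ⟨Z, hZ⟩ : ∃ Z : ℝ, 81 * ∑' m : ℕ, (((m : ℝ) + 1) ^ 2)⁻¹ = Z := ⟨_, rfl⟩
  have hZ0 : 0 ≤ Z := by rw [← hZ]; exact mul_nonneg (by norm_num) (tsum_nonneg fun m => by positivity)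
  set k₁ : ℝ := (24 * δ) ^ P + 1 with hk₁
  set k₂ : ℝ := (3 / 2) ^ 6 * 12 ^ E + 22 ^ E with hk₂
  have hk₁0 : 0 ≤ k₁ := by positivity
  have hk₂0 : 0 ≤ k₂ := by positivity
  refine ⟨2 ^ 12 * 7 * Z * (k₁ + k₂), 6 + E + P, by positivity, ?_⟩
  intro n hn L R₀ a M B W y F ha ha24 hL hR₀ hRa _hfit hM hB hWsup hWsep hyx hF
  have hn0 : n ≠ 0 := by omega
  have ha1 : a ≤ 1 := ha24.trans (by norm_num)
  -- the seminorm budget against `schwartzNorm ((6+E+P) n)`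
  set sN := schwartzNorm ((6 + E + P) * n) F with hsN
  have hsN0 : 0 ≤ sN := schwartzNorm_nonneg _ _
  set S7 := SchwartzMap.seminorm ℂ 0 0 F + SchwartzMap.seminorm ℂ (6 * n) 0 F +
      SchwartzMap.seminorm ℂ 0 (P * n) F + SchwartzMap.seminorm ℂ (6 * n) (P * n) F +
      SchwartzMap.seminorm ℂ ((6 + E) * n) 0 F +
      SchwartzMap.seminorm ℂ 0 (E * n) F + SchwartzMap.seminorm ℂ (6 * n) (E * n) F with hS7
  have h6 : 6 * n ≤ (6 + E + P) * n := Nat.mul_le_mul_right n (by omega)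
  have hP : P * n ≤ (6 + E + P) * n := Nat.mul_le_mul_right n (by omega)
  have hE : E * n ≤ (6 + E + P) * n := Nat.mul_le_mul_right n (by omega)
  have h6E : (6 + E) * n ≤ (6 + E + P) * n := Nat.mul_le_mul_right n (by omega)
  have hS7le : S7 ≤ 7 * sN := by
    have t1 := seminorm_le_schwartzNorm (m := (6 + E + P) * n) (k := 0) (l := 0) (by omega) (by omega) F
    have t2 := seminorm_le_schwartzNorm (m := (6 + E + P) * n) (k := 6 * n) (l := 0) h6 (by omega) F
    have t3 := seminorm_le_schwartzNorm (m := (6 + E + P) * n) (k := 0) (l := P * n) (by omega) hP F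
    have t4 := seminorm_le_schwartzNorm (m := (6 + E + P) * n) (k := 6 * n) (l := P * n) h6 hP F
    have t5 := seminorm_le_schwartzNorm (m := (6 + E + P) * n) (k := (6 + E) * n) (l := 0) h6E (by omega) F
    have t6 := seminorm_le_schwartzNorm (m := (6 + E + P) * n) (k := 0) (l := E * n) (by omega) hE F
    have t7 := seminorm_le_schwartzNorm (m := (6 + E + P) * n) (k := 6 * n) (l := E * n) h6 hE F
    rw [hS7, hsN]; linarith
  have hS70 : 0 ≤ S7 := by rw [hS7]; positivity
  -- the per-point constant
  set c₁ : ℝ := (24 * δ) ^ (P * n) + 1 with hc₁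
  set c₂ : ℝ := (3 / 2) ^ (6 * n) * 12 ^ (E * n) + 22 ^ (E * n) with hc₂
  have hc₁le : c₁ ≤ k₁ ^ n := by
    have h := pow_add_pow_le (pow_nonneg (by positivity : (0:ℝ) ≤ 24 * δ) P) zero_le_one hn0
    rw [one_pow, ← pow_mul] at h
    rw [hc₁, hk₁]; exact h
  have hc₂le : c₂ ≤ k₂ ^ n := by
    rw [hc₂, hk₂, pow_mul, pow_mul, pow_mul, ← mul_pow]
    exact pow_add_pow_le (by positivity) (by positivity) hn0
  set Cpt : ℝ := 2 ^ (6 * n) * (B ^ n * c₁ + M ^ n * a ^ (E * n) * c₂) * S7 with hCpt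
  have hCpt0 : 0 ≤ Cpt := by positivity
  -- per point
  have hpt : ∀ x ∈ Fintype.piFinset (fun _ : Fin n => box 4 L),
      |W x| * ‖F (y x)‖ ≤ Cpt * ∏ i, (2 ^ 6 * ((1 + a * ‖x i‖) ^ 6)⁻¹) := fun x hx => by
    have hq : 0 < (1 + ‖y x‖) ^ (6 * n) := by positivity
    have h2 := (le_div_iff₀ hq).2
      (ssb_pointwise F hF ha ha24 hL hR₀ hδ hRa hM hB (P := P) (E := E) W hWsup x (hWsep x hx) hn (y x) (hyx x))
    rw [div_eq_mul_inv] at h2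
    refine h2.trans (mul_le_mul_of_nonneg_left ?_ hCpt0)
    have h3 := inv_one_add_norm_pow_le_prod' ha.le x (y x)
      (fun i => by have := norm_ge_of_shift ha.le (hyx x) i; linarith) 6
    rwa [inv_pow, ← pow_mul] at h3
  -- sum of the lattice weights
  have hfac : ∀ x : Fin n → Site 4, ∏ i, (2 ^ 6 * ((1 + a * ‖x i‖) ^ 6)⁻¹) =
      (2 : ℝ) ^ (6 * n) * (a ^ (4 * n))⁻¹ * ∏ i, (a ^ 4 * ((1 + a * ‖x i‖) ^ 6)⁻¹) := fun x => by
    rw [Finset.prod_mul_distrib, Finset.prod_mul_distrib, Finset.prod_const, Finset.prod_const,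
      Finset.card_univ, Fintype.card_fin, ← pow_mul, ← pow_mul]
    have : (a ^ (4 * n))⁻¹ * a ^ (4 * n) = 1 := inv_mul_cancel₀ (by positivity)
    calc (2 : ℝ) ^ (6 * n) * ∏ i, ((1 + a * ‖x i‖) ^ 6)⁻¹
        = 2 ^ (6 * n) * ((a ^ (4 * n))⁻¹ * a ^ (4 * n)) * ∏ i, ((1 + a * ‖x i‖) ^ 6)⁻¹ := by rw [this, mul_one]
      _ = _ := by ring
  have hsumZ : ∑ x ∈ Fintype.piFinset (fun _ : Fin n => box 4 L), ∏ i, (2 ^ 6 * ((1 + a * ‖x i‖) ^ 6)⁻¹) ≤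
      (2 : ℝ) ^ (6 * n) * (a ^ (4 * n))⁻¹ * Z ^ n := by
    simp_rw [hfac]
    rw [← Finset.mul_sum]
    refine mul_le_mul_of_nonneg_left ?_ (by positivity)
    rw [← hZ]; exact sum_prod_decay_le ha ha1 (le_refl 6) (box 4 L) n
  -- assemble
  have hsum : ∑ x ∈ Fintype.piFinset (fun _ : Fin n => box 4 L), |W x| * ‖F (y x)‖ ≤
      Cpt * ((2 : ℝ) ^ (6 * n) * (a ^ (4 * n))⁻¹ * Z ^ n) := by
    calc ∑ x ∈ Fintype.piFinset (fun _ : Fin n => box 4 L), |W x| * ‖F (y x)‖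
        ≤ ∑ x ∈ Fintype.piFinset (fun _ : Fin n => box 4 L), Cpt * ∏ i, (2 ^ 6 * ((1 + a * ‖x i‖) ^ 6)⁻¹) :=
          Finset.sum_le_sum hpt
      _ = Cpt * ∑ x ∈ Fintype.piFinset (fun _ : Fin n => box 4 L), ∏ i, (2 ^ 6 * ((1 + a * ‖x i‖) ^ 6)⁻¹) := by
          rw [Finset.mul_sum]
      _ ≤ Cpt * ((2 : ℝ) ^ (6 * n) * (a ^ (4 * n))⁻¹ * Z ^ n) := mul_le_mul_of_nonneg_left hsumZ hCpt0
  have hnorm : ‖∑ x ∈ Fintype.piFinset (fun _ : Fin n => box 4 L), ((W x : ℝ) : ℂ) * F (y x)‖ ≤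
      ∑ x ∈ Fintype.piFinset (fun _ : Fin n => box 4 L), |W x| * ‖F (y x)‖ := by
    refine (norm_sum_le _ _).trans (le_of_eq (Finset.sum_congr rfl fun x _ => ?_))
    rw [norm_mul, Complex.norm_real, Real.norm_eq_abs]
  have ha4 : 0 < a ^ (4 * n) := by positivity
  calc a ^ (4 * n) * ‖∑ x ∈ Fintype.piFinset (fun _ : Fin n => box 4 L), ((W x : ℝ) : ℂ) * F (y x)‖
      ≤ a ^ (4 * n) * (Cpt * ((2 : ℝ) ^ (6 * n) * (a ^ (4 * n))⁻¹ * Z ^ n)) :=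
        mul_le_mul_of_nonneg_left (hnorm.trans hsum) ha4.le
    _ = (2 : ℝ) ^ (6 * n) * 2 ^ (6 * n) * Z ^ n * (B ^ n * c₁ + M ^ n * a ^ (E * n) * c₂) * S7 := by
        rw [hCpt]; field_simp
    _ ≤ (2 : ℝ) ^ (6 * n) * 2 ^ (6 * n) * Z ^ n * ((B ^ n + M ^ n * a ^ (E * n)) * (k₁ + k₂) ^ n) * (7 * sN) := by
        have h1 : B ^ n * c₁ + M ^ n * a ^ (E * n) * c₂ ≤ (B ^ n + M ^ n * a ^ (E * n)) * (k₁ + k₂) ^ n := by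
          have hk1n : k₁ ^ n ≤ (k₁ + k₂) ^ n := pow_le_pow_left₀ hk₁0 (by linarith) n
          have hk2n : k₂ ^ n ≤ (k₁ + k₂) ^ n := pow_le_pow_left₀ hk₂0 (by linarith) n
          have hBn : 0 ≤ B ^ n := by positivity
          have hMn : 0 ≤ M ^ n * a ^ (E * n) := by positivity
          calc B ^ n * c₁ + M ^ n * a ^ (E * n) * c₂
              ≤ B ^ n * (k₁ + k₂) ^ n + M ^ n * a ^ (E * n) * (k₁ + k₂) ^ n :=
                add_le_add (mul_le_mul_of_nonneg_left (hc₁le.trans hk1n) hBn)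
                  (mul_le_mul_of_nonneg_left (hc₂le.trans hk2n) hMn)
            _ = _ := by ring
        have h0 : (0 : ℝ) ≤ 2 ^ (6 * n) * 2 ^ (6 * n) * Z ^ n := by positivity
        calc (2 : ℝ) ^ (6 * n) * 2 ^ (6 * n) * Z ^ n * (B ^ n * c₁ + M ^ n * a ^ (E * n) * c₂) * S7
            = (2 : ℝ) ^ (6 * n) * 2 ^ (6 * n) * Z ^ n * ((B ^ n * c₁ + M ^ n * a ^ (E * n) * c₂) * S7) := by ring
          _ ≤ (2 : ℝ) ^ (6 * n) * 2 ^ (6 * n) * Z ^ n * (((B ^ n + M ^ n * a ^ (E * n)) * (k₁ + k₂) ^ n) * (7 * sN)) :=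
              mul_le_mul_of_nonneg_left (mul_le_mul h1 hS7le hS70 (by positivity)) h0
          _ = _ := by ring
    _ ≤ (2 ^ 12 * 7 * Z * (k₁ + k₂)) ^ n * (B ^ n + M ^ n * a ^ (E * n)) * sN := by
        have h7 : (7 : ℝ) ≤ 7 ^ n := le_self_pow₀ (by norm_num) hn0
        have hrest : 0 ≤ (2 : ℝ) ^ (6 * n) * 2 ^ (6 * n) * Z ^ n * ((B ^ n + M ^ n * a ^ (E * n)) * (k₁ + k₂) ^ n) * sN := by
          positivity
        calc (2 : ℝ) ^ (6 * n) * 2 ^ (6 * n) * Z ^ n * ((B ^ n + M ^ n * a ^ (E * n)) * (k₁ + k₂) ^ n) * (7 * sN)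
            = 7 * ((2 : ℝ) ^ (6 * n) * 2 ^ (6 * n) * Z ^ n * ((B ^ n + M ^ n * a ^ (E * n)) * (k₁ + k₂) ^ n) * sN) := by
              ring
          _ ≤ 7 ^ n * ((2 : ℝ) ^ (6 * n) * 2 ^ (6 * n) * Z ^ n * ((B ^ n + M ^ n * a ^ (E * n)) * (k₁ + k₂) ^ n) * sN) :=
              mul_le_mul_of_nonneg_right h7 hrest
          _ = (2 ^ 12 * 7 * Z * (k₁ + k₂)) ^ n * (B ^ n + M ^ n * a ^ (E * n)) * sN := by
              have h2 : (2 : ℝ) ^ (6 * n) * 2 ^ (6 * n) = (2 ^ 12) ^ n := by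
                rw [← pow_mul, ← pow_add]; congr 1; ring
              rw [mul_pow, mul_pow, mul_pow, ← h2]; ring

end Summit.QuantumFields.YangMills.Cruxes.HypercubicLimit.ConditionalMeanTelescoping

end
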